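import Mathlib
import Summits.Ventures.HodgeRepro2.A1BaseChange
import Summits.Ventures.HodgeRepro2.A1EigenlinePermutation
import Summits.Ventures.HodgeRepro2.A1ExteriorBaseChange
import Summits.Ventures.HodgeRepro2.A1GaloisTensorSplitting
import Summits.Ventures.HodgeRepro2.A1EigenlineDecompositionGalois
import Summits.Ventures.HodgeRepro2.A1SplitSummandDescent

/-!
# The descended subspace surjects onto `⋀^n_F V`

Blind cell `pub-hodge-repro2`, seat p7 (gen 10), A1 annex (route/T4-A1-p7.md, Lemma A1.3's first
sentence; route/LEAN-ANNEX-p7.md §4, clause (ii) «the descended subspace is Deligne's `∧^n_F V`»).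
`A1SplitSummandDescent` produced a `K`-subspace `W₀ ⊆ ⋀^n_K V` with `W₀ ⊗ L = ⊕_σ ⋀^n_L V_σ`.
Deligne's `∧^n_F V ⊂ ∧^n_K V` is this `W₀` read through the canonical surjection
`π : ⋀^n_K V → ⋀^n_F V` (restriction of scalars).  This file proves the first half of the
identification: **`π` maps `W₀` ONTO `⋀^n_F V`** (`restrictMap_map_eq_top_of_baseChange_eq`,
`exists_descended_surjects`).  The mechanism: after base change, `π` becomes
`Φ : ⋀^n_L (L ⊗ V) → L ⊗ ⋀^n_F V`, the `F`-action on `⋀^n_F V` acts through ANY one slot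
(`actF_Φ_ιMulti`), so a wedge of eigenvectors of one eigenline `V_σ` lands in the `σ`-eigenline of
`L ⊗ ⋀^n_F V` (`Φ_ιMulti_mem_eigenline`) and a MIXED wedge (two slots in different eigenlines) is
killed (`Φ_ιMulti_eq_zero_of_ne`); since `⋀^n_L (L ⊗ V)` is spanned by wedges of eigenvectors
(`L ⊗ V = ⊕_σ V_σ`), `Φ` maps the split summand onto everything (`map_eigenSummand_Φ`), and the
statement descends.  `n ≥ 1` throughout (`[NeZero n]`; for `n = 0` the map `K → F` is not onto).

What stays prose (A1 §4): injectivity of `π` on `W₀` (the other half of (ii)) and the geometry.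

README §8(d): uses an L-value-free non-vanishing device: NO.
-/

namespace Summit.Ventures.HodgeRepro2.A1DescendedSurjection

open TensorProduct
open Summit.Ventures.HodgeRepro2.A1EigenlinePermutation
open Summit.Ventures.HodgeRepro2.A1ExteriorBaseChange
open Summit.Ventures.HodgeRepro2.A1GaloisTensorSplitting
open Summit.Ventures.HodgeRepro2.A1EigenlineDecompositionGalois
open Summit.Ventures.HodgeRepro2.A1SplitSummandDescent

section Restrict

variable (K F V : Type*) [Field K] [Field F] [Algebra K F] [AddCommGroup V] [Module K V]
  [Module F V] [IsScalarTower K F V] (n : ℕ)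

/-- The canonical surjection `π : ⋀^n_K V → ⋀^n_F V` (restriction of scalars),
`v₁ ∧_K … ∧_K vₙ ↦ v₁ ∧_F … ∧_F vₙ`. -/
noncomputable def restrictMap : ⋀[K]^n V →ₗ[K] ⋀[F]^n V :=
  exteriorPower.alternatingMapLinearEquiv (ιMultiRestrict K F n V)

/-- `π (v₁ ∧_K … ∧_K vₙ) = v₁ ∧_F … ∧_F vₙ`. -/
@[simp] theorem restrictMap_ιMulti (v : Fin n → V) :
    restrictMap K F V n (exteriorPower.ιMulti K n v) = exteriorPower.ιMulti F n v := by
  simp [restrictMap]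

/-- The range of `π` is stable under the `F`-scalars (`n ≥ 1`: act on the first slot). -/
theorem smul_mem_range_restrictMap [NeZero n] (x : F) {y : ⋀[F]^n V}
    (hy : y ∈ LinearMap.range (restrictMap K F V n)) :
    x • y ∈ LinearMap.range (restrictMap K F V n) := by
  obtain ⟨z, rfl⟩ := hy
  have hz : z ∈ Submodule.span K (Set.range (exteriorPower.ιMulti K n)) := by
    rw [exteriorPower.ιMulti_span]; exact Submodule.mem_top
  induction hz using Submodule.span_induction with
  | mem z hz =>
    obtain ⟨v, rfl⟩ := hz
    refine ⟨exteriorPower.ιMulti K n (Function.update v 0 (x • v 0)), ?_⟩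
    rw [restrictMap_ιMulti, restrictMap_ιMulti, AlternatingMap.map_update_smul,
      Function.update_eq_self]
  | zero => simp
  | add z₁ z₂ _ _ h₁ h₂ => rw [map_add, smul_add]; exact Submodule.add_mem _ h₁ h₂
  | smul c z _ h => rw [LinearMap.map_smul, smul_comm]; exact Submodule.smul_mem _ _ h

/-- **`π` is surjective** for `n ≥ 1`. -/
theorem restrictMap_surjective [NeZero n] : Function.Surjective (restrictMap K F V n) := by
  intro y
  have hy : y ∈ Submodule.span F (Set.range (exteriorPower.ιMulti F n)) := by
    rw [exteriorPower.ιMulti_span]; exact Submodule.mem_top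
  induction hy using Submodule.span_induction with
  | mem y hy =>
    obtain ⟨v, rfl⟩ := hy
    exact ⟨exteriorPower.ιMulti K n v, restrictMap_ιMulti K F V n v⟩
  | zero => exact ⟨0, map_zero _⟩
  | add y₁ y₂ _ _ h₁ h₂ =>
    obtain ⟨z₁, rfl⟩ := h₁
    obtain ⟨z₂, rfl⟩ := h₂
    exact ⟨z₁ + z₂, map_add _ _ _⟩
  | smul c y _ h => exact smul_mem_range_restrictMap K F V n c h

end Restrict

section Phi

variable (K L : Type*) [Field K] [Field L] [Algebra K L]
variable (F : Type*) [Field F] [Algebra K F]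
variable (V : Type*) [AddCommGroup V] [Module K V] [Module F V] [IsScalarTower K F V]
variable (n : ℕ) {I : Type*} [LinearOrder I] (b : Module.Basis I K V)

/-- `π` after base change, read on `⋀^n_L (L ⊗ V)` through the base-change isomorphism:
`Φ = (π ⊗ L) ∘ baseChangeEquiv⁻¹ : ⋀^n_L (L ⊗_K V) → L ⊗_K ⋀^n_F V`. -/
noncomputable def Φ : ⋀[L]^n (L ⊗[K] V) →ₗ[L] L ⊗[K] ⋀[F]^n V :=
  (restrictMap K F V n).baseChange L ∘ₗ (baseChangeEquiv K L V n b).symm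

/-- `Φ ((1 ⊗ v₁) ∧ … ∧ (1 ⊗ vₙ)) = 1 ⊗ (v₁ ∧_F … ∧_F vₙ)`. -/
theorem Φ_ιMulti_one_tmul (v : Fin n → V) :
    Φ K L F V n b (exteriorPower.ιMulti L n (fun i => (1 : L) ⊗ₜ[K] v i)) =
      (1 : L) ⊗ₜ[K] exteriorPower.ιMulti F n v := by
  rw [Φ, LinearMap.comp_apply, LinearEquiv.coe_coe, baseChangeEquiv_symm_ιMulti,
    LinearMap.baseChange_tmul, restrictMap_ιMulti]

/-- `Φ` is surjective for `n ≥ 1`. -/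
theorem Φ_surjective [NeZero n] : Function.Surjective (Φ K L F V n b) := by
  rw [Φ, LinearMap.coe_comp, LinearEquiv.coe_coe]
  refine Function.Surjective.comp ?_ (baseChangeEquiv K L V n b).symm.surjective
  rw [LinearMap.baseChange_eq_ltensor]
  exact LinearMap.lTensor_surjective L (restrictMap_surjective K F V n)

/-- `Function.update` in `if`-form. -/
theorem update_eq_ite {α : Type*} [DecidableEq α] {β : Type*} (w : α → β) (i : α) (f : β → β) :
    Function.update w i (f (w i)) = fun j => if j = i then f (w j) else w j := by
  ext j
  by_cases h : j = i
  · subst h; simp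
  · simp [h]

/-- **The `F`-action on `⋀^n_F V` acts through any single slot**: for every slot `i`,
`actF x (Φ (w₁ ∧ … ∧ wₙ)) = Φ (w₁ ∧ … ∧ actF x wᵢ ∧ … ∧ wₙ)`. -/
theorem actF_Φ_ιMulti (x : F) (i : Fin n) (w : Fin n → L ⊗[K] V) :
    actF L x (Φ K L F V n b (exteriorPower.ιMulti L n w)) =
      Φ K L F V n b (exteriorPower.ιMulti L n (Function.update w i (actF L x (w i)))) := by
  -- both sides are `L`-multilinear in `w`; compare on the basis `1 ⊗ b j` of `L ⊗ V`
  let f : MultilinearMap L (fun _ : Fin n => L ⊗[K] V) (L ⊗[K] ⋀[F]^n V) :=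
    (actF L x ∘ₗ Φ K L F V n b).compMultilinearMap (exteriorPower.ιMulti L n).toMultilinearMap
  let g : MultilinearMap L (fun _ : Fin n => L ⊗[K] V) (L ⊗[K] ⋀[F]^n V) :=
    ((Φ K L F V n b).compMultilinearMap
      (exteriorPower.ιMulti L n).toMultilinearMap).compLinearMap
        (fun j => if j = i then actF L x else LinearMap.id)
  have key : f = g := by
    apply Module.Basis.ext_multilinear (fun _ => Algebra.TensorProduct.basis L b)
    intro v
    simp only [f, g, LinearMap.compMultilinearMap_apply, MultilinearMap.compLinearMap_apply,
      AlternatingMap.coe_multilinearMap, LinearMap.comp_apply, Algebra.TensorProduct.basis_apply]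
    have h1 : (fun j => (if j = i then actF L x else LinearMap.id) ((1 : L) ⊗ₜ[K] b (v j))) =
        fun j => (1 : L) ⊗ₜ[K] (Function.update (fun j => b (v j)) i (x • b (v i)) j) := by
      ext j
      by_cases h : j = i
      · subst h; simp
      · simp [h]
    rw [h1, Φ_ιMulti_one_tmul, Φ_ιMulti_one_tmul, actF_tmul, AlternatingMap.map_update_smul,
      Function.update_eq_self]
  have := congrFun (congrArg DFunLike.coe key) w
  simp only [f, g, LinearMap.compMultilinearMap_apply, MultilinearMap.compLinearMap_apply,
    AlternatingMap.coe_multilinearMap, LinearMap.comp_apply] at this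
  rw [this, update_eq_ite]
  congr 2
  ext j
  by_cases h : j = i
  · subst h; simp
  · simp [h]

/-- **A wedge of eigenvectors of one eigenline `V_σ` lands in the `σ`-eigenline** of
`L ⊗ ⋀^n_F V` (`n ≥ 1`). -/
theorem Φ_ιMulti_mem_eigenline [NeZero n] (σ : F →ₐ[K] L) (w : Fin n → L ⊗[K] V)
    (hw : ∀ i, w i ∈ eigenline L V σ) :
    Φ K L F V n b (exteriorPower.ιMulti L n w) ∈ eigenline L (⋀[F]^n V) σ := by
  rw [mem_eigenline_iff]
  intro x
  rw [actF_Φ_ιMulti K L F V n b x 0 w, (mem_eigenline_iff σ _).mp (hw 0) x,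
    AlternatingMap.map_update_smul, Function.update_eq_self, map_smul]

/-- **A mixed wedge is killed**: if two slots lie in different eigenlines, `Φ (w₁ ∧ … ∧ wₙ) = 0`. -/
theorem Φ_ιMulti_eq_zero_of_ne (σ τ : F →ₐ[K] L) (hστ : σ ≠ τ) (i j : Fin n)
    (w : Fin n → L ⊗[K] V) (hi : w i ∈ eigenline L V σ) (hj : w j ∈ eigenline L V τ) :
    Φ K L F V n b (exteriorPower.ιMulti L n w) = 0 := by
  obtain ⟨x, hx⟩ := DFunLike.ne_iff.mp hστ
  have h1 : actF L x (Φ K L F V n b (exteriorPower.ιMulti L n w)) =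
      σ x • Φ K L F V n b (exteriorPower.ιMulti L n w) := by
    rw [actF_Φ_ιMulti K L F V n b x i w, (mem_eigenline_iff σ _).mp hi x, AlternatingMap.map_update_smul,
      Function.update_eq_self, map_smul]
  have h2 : actF L x (Φ K L F V n b (exteriorPower.ιMulti L n w)) =
      τ x • Φ K L F V n b (exteriorPower.ιMulti L n w) := by
    rw [actF_Φ_ιMulti K L F V n b x j w, (mem_eigenline_iff τ _).mp hj x, AlternatingMap.map_update_smul,
      Function.update_eq_self, map_smul]
  have h3 := sub_smul (σ x) (τ x) (Φ K L F V n b (exteriorPower.ιMulti L n w))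
  rw [← h1, ← h2, sub_self] at h3
  exact (smul_eq_zero.mp h3).resolve_left (sub_ne_zero.mpr hx)

/-- `π` commutes with base change of subspaces: `(π W₀) ⊗ L = (π ⊗ L)(W₀ ⊗ L)`. -/
theorem baseChange_map_restrictMap (W₀ : Submodule K (⋀[K]^n V)) :
    (W₀.map (restrictMap K F V n)).baseChange L =
      (W₀.baseChange L).map ((restrictMap K F V n).baseChange L) := by
  conv_lhs => rw [← Submodule.span_eq W₀]
  conv_rhs => rw [← Submodule.span_eq W₀]
  rw [Submodule.map_span, Submodule.baseChange_span, Submodule.baseChange_span, Submodule.map_span,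
    Set.image_image, Set.image_image]
  refine congrArg (Submodule.span L) (Set.image_congr fun w _ => ?_)
  simp [LinearMap.baseChange_tmul]

end Phi

section Onto

variable (K L : Type*) [Field K] [Field L] [Algebra K L]
variable (F : Type*) [Field F] [Algebra K F] [FiniteDimensional K F]
variable (V : Type*) [AddCommGroup V] [Module K V] [Module F V] [IsScalarTower K F V]
variable (n : ℕ) [NeZero n] {I : Type*} [LinearOrder I] (b : Module.Basis I K V)
variable [Fintype (Emb K L F)] [DecidableEq (Emb K L F)]

/-- **`Φ` maps the split summand `⊕_σ ⋀^n V_σ` onto `L ⊗ ⋀^n_F V`**: `⋀^n_L (L ⊗ V)` is spanned by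
wedges of eigenvectors, the pure ones lie in the split summand, the mixed ones are killed. -/
theorem map_eigenSummand_Φ (hcard : Fintype.card (Emb K L F) = Module.finrank K F) :
    (eigenSummand K L F V n).map (Φ K L F V n b) = ⊤ := by
  classical
  have hspan : Submodule.span L (⋃ σ : Emb K L F, (eigenline L V σ : Set (L ⊗[K] V))) = ⊤ := by
    rw [Submodule.span_iUnion]
    simp only [Submodule.span_eq]
    exact iSup_eigenline_eq_top K L F V hcard
  have htop := exteriorPower.ιMulti_span_of_span L n (L ⊗[K] V) hspan
  have h1 : Submodule.map (Φ K L F V n b) ⊤ = ⊤ := by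
    rw [Submodule.map_top, LinearMap.range_eq_top]
    exact Φ_surjective K L F V n b
  refine top_le_iff.mp ?_
  calc (⊤ : Submodule L (L ⊗[K] ⋀[F]^n V)) = Submodule.map (Φ K L F V n b) ⊤ := h1.symm
    _ = Submodule.map (Φ K L F V n b) (Submodule.span L
          (exteriorPower.ιMulti L n '' {a | Set.range a ⊆ ⋃ σ : Emb K L F,
            (eigenline L V σ : Set (L ⊗[K] V))})) := by rw [htop]
    _ = Submodule.span L (Φ K L F V n b '' (exteriorPower.ιMulti L n '' {a | Set.range a ⊆
          ⋃ σ : Emb K L F, (eigenline L V σ : Set (L ⊗[K] V))})) := Submodule.map_span _ _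
    _ ≤ (eigenSummand K L F V n).map (Φ K L F V n b) := by
      rw [Submodule.span_le]
      rintro _ ⟨_, ⟨a, ha, rfl⟩, rfl⟩
      have ha' : ∀ i, ∃ σ : Emb K L F, a i ∈ eigenline L V σ := fun i => by
        have := ha ⟨i, rfl⟩
        simpa [Set.mem_iUnion] using this
      choose σ' hσ' using ha'
      by_cases hpure : ∀ i, σ' i = σ' 0
      · refine Submodule.mem_map_of_mem (ιMulti_mem_splitSummand n _ (σ' 0) a fun i => ?_)
        rw [← hpure i]
        exact hσ' i
      · push Not at hpure
        obtain ⟨i, hi⟩ := hpure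
        rw [Φ_ιMulti_eq_zero_of_ne K L F V n b (σ' i) (σ' 0) hi i 0 a (hσ' i) (hσ' 0)]
        exact Submodule.zero_mem _

/-- **The descended subspace surjects onto `⋀^n_F V`**: if `W₀ ⊗ L` is the split summand (read in
`L ⊗ ⋀^n_K V`), then `π (W₀) = ⋀^n_F V`. -/
theorem restrictMap_map_eq_top_of_baseChange_eq
    (hcard : Fintype.card (Emb K L F) = Module.finrank K F) (W₀ : Submodule K (⋀[K]^n V))
    (hW₀ : W₀.baseChange L = eigenSummandK K L F V n b) :
    W₀.map (restrictMap K F V n) = ⊤ := by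
  apply Summit.Ventures.HodgeRepro2.A1BaseChange.baseChange_injective (K := L)
  show (W₀.map (restrictMap K F V n)).baseChange L = (⊤ : Submodule K (⋀[F]^n V)).baseChange L
  rw [Submodule.baseChange_top, baseChange_map_restrictMap, hW₀, eigenSummandK,
    Submodule.comap_equiv_eq_map_symm, ← Submodule.map_comp]
  exact map_eigenSummand_Φ K L F V n b hcard

/-- **Lemma A1.3, first sentence, surjective half**: for `L/K` finite Galois receiving all
embeddings of `F`, there is a `K`-subspace `W₀ ⊆ ⋀^n_K V` with `W₀ ⊗ L = ⊕_σ ⋀^n_L V_σ` and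
`π (W₀) = ⋀^n_F V`. -/
theorem exists_descended_surjects [FiniteDimensional K L] [IsGalois K L]
    (hcard : Fintype.card (Emb K L F) = Module.finrank K F) :
    ∃ W₀ : Submodule K (⋀[K]^n V), W₀.baseChange L = eigenSummandK K L F V n b ∧
      W₀.map (restrictMap K F V n) = ⊤ := by
  obtain ⟨W₀, hW₀⟩ := exists_baseChange_eq_eigenSummandK K L F V n b
  exact ⟨W₀, hW₀, restrictMap_map_eq_top_of_baseChange_eq K L F V n b hcard W₀ hW₀⟩

end Onto

section GaloisSelf

variable (K F : Type*) [Field K] [Field F] [Algebra K F] [FiniteDimensional K F] [IsGalois K F]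
variable (V : Type*) [AddCommGroup V] [Module K V] [Module F V] [IsScalarTower K F V]
variable (n : ℕ) [NeZero n] {I : Type*} [LinearOrder I] (b : Module.Basis I K V)

/-- **Over the Galois CM field itself** (`L = F`): a `K`-subspace `W₀ ⊆ ⋀^n_K V` with
`W₀ ⊗ F = ⊕_{σ : F → F} ⋀^n V_σ` and `π (W₀) = ⋀^n_F V`. -/
theorem exists_descended_surjects_self [DecidableEq (Emb K F F)] :
    ∃ W₀ : Submodule K (⋀[K]^n V), W₀.baseChange F = eigenSummandK K F F V n b ∧
      W₀.map (restrictMap K F V n) = ⊤ :=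
  exists_descended_surjects K F F V n b (card_algHom_self K F)

end GaloisSelf

end Summit.Ventures.HodgeRepro2.A1DescendedSurjection
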